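import Mathlib
import Summits.KontsevichZagierPeriods.KontsevichZagierPeriods.Theorems.RealEllipticSectorKernel.Negative.Core
import Literature.NumberTheory.Transcendental.SemialgebraicMapsProofs

/-!
# drefute gen 3 — candidate proof of the worker stub `stub_twoTorsion`
# (crux stmt-KontsevichZagierPeriods-10632 `RealEllipticSectorKernel`, line `oval-hermite-engine`,
# skeleton `Lines/oval-hermite-engine.lean` sha256 `be982d63baee…`)

Refuter seat `refuter-drefute-stmt-KontsevichZagierPeriods-10632-g3-0`. CERTIFICATE for the stub
attack ("the stub is a theorem exactly as typed"): `stub_twoTorsion` below has the REGISTERED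
signature verbatim, in the refuter namespace `…RealEllipticSectorKernel.DrefuteG3` (no tree FQN is
redeclared). The proof is ONE `KZ.changeOfVariablesRel` instance between the two GIVEN
presentations `r''` (source, domain `(e₁,∞)`) and `r` (target, domain `(e₃,e₂)`), with
`Φ(x) = e₂ + (e₂ − e₁)(e₂ − e₃)/(x − e₂)` — translation by the `2`-torsion point `(e₂,0)`; every
side condition of rule 2 on the UNBOUNDED domain is discharged from (a verbatim copy, Part A, of) the landed helper file
`Theorems/HermiteRigidityTwoTorsionTransferMove.lean` (item 3413: `phi_semialgebraic`,
`image_phi_eq`, `phi_mem_Ioo`, `hasDerivAt_phi`, `cubic_phi`) after Vieta (`e₃ = −e₁ − e₂`,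
`q₂ = 4(e₁² + e₁e₂ + e₂²)`, `q₃ = −4e₁e₂(e₁+e₂)`) is read off the hypothesis `hf` at `x = 0, ±1`.
The semialgebraicity of the source domain `(e₁,∞)` is FREE: it is the field
`r''.isSemialgebraic_domain`. The hypotheses `ha₁ ha₂ ha₃` (algebraicity of the roots) are not used: a warning-free landing
of the VERBATIM signature must underscore them (`_ha₁ _ha₂ _ha₃`, as below — binder names are not part
of the statement; the composition passes them positionally) or consume them; otherwise the gate
bounces `lint.warning: unusedVariables`.
-/

noncomputable section

open MeasureTheory Set

/-! # Part A — the real algebra / semialgebraic geometry of `Φ`, VERBATIM from the landed helper file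
`Theorems/HermiteRigidityTwoTorsionTransferMove.lean` (item 3413, p78052; re-homed to the namespace
`…DrefuteG3.MoveCopy` only because the farm serves that module unbuilt at the time of writing —
no FQN of the tree is redeclared). -/

namespace Summit.KontsevichZagierPeriods.HermiteRigidity.RealEllipticSectorKernel.DrefuteG3.MoveCopy

open Set MvPolynomial
open Literature.NumberTheory.Transcendental Literature.ModelTheory.ExponentialFields

/-! ### The `2`-torsion translation `Φ(x) = e₂ + (e₂ − e₁)(e₂ − e₃)/(x − e₂)` -/

/-- **Invariance of `dx/y` under a `2`-torsion translation** (Whittaker–Watson §20.33 differentiated):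
with `Φ(x) = e₂ + a/(x − e₂)`, `a = (e₂ − e₁)(e₁ + 2e₂) = (e₂ − e₁)(e₂ − e₃)`, one has
`f(Φ(x)) = Φ′(x)² f(x)`, `Φ′(x) = −a/(x − e₂)²`, for `f(x) = 4(x − e₁)(x − e₂)(x + e₁ + e₂)`.
[cite: WhittakerWatson1927, §20.33] -/
theorem cubic_phi (e₁ e₂ x : ℝ) (hx : x ≠ e₂) :
    4 * (e₂ + (e₂ - e₁) * (e₁ + 2 * e₂) / (x - e₂) - e₁) *
        (e₂ + (e₂ - e₁) * (e₁ + 2 * e₂) / (x - e₂) - e₂) *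
        (e₂ + (e₂ - e₁) * (e₁ + 2 * e₂) / (x - e₂) + e₁ + e₂) =
      (-((e₂ - e₁) * (e₁ + 2 * e₂)) / (x - e₂) ^ 2) ^ 2 *
        (4 * (x - e₁) * (x - e₂) * (x + e₁ + e₂)) := by
  have h : x - e₂ ≠ 0 := sub_ne_zero.mpr hx
  field_simp
  ring

/-- `Φ` is an involution off `x = e₂` (`(e₂, 0)` is `2`-torsion). [folklore] -/
theorem phi_phi {a e₂ y : ℝ} (ha : a ≠ 0) (hy : y ≠ e₂) :
    e₂ + a / (e₂ + a / (y - e₂) - e₂) = y := by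
  have h1 : y - e₂ ≠ 0 := sub_ne_zero.mpr hy
  have h2 : e₂ + a / (y - e₂) - e₂ = a / (y - e₂) := by ring
  rw [h2]
  field_simp
  ring

/-- The derivative of `Φ(x) = e₂ + a/(x − e₂)` is `−a/(x − e₂)²`. [folklore] -/
theorem hasDerivAt_phi (a e₂ x : ℝ) (hx : x ≠ e₂) :
    HasDerivAt (fun y => e₂ + a / (y - e₂)) (-a / (x - e₂) ^ 2) x := by
  have h0 : x - e₂ ≠ 0 := sub_ne_zero.mpr hx
  have h1 : HasDerivAt (fun y => y - e₂) 1 x := (hasDerivAt_id x).sub_const e₂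
  have h2 : HasDerivAt (fun y => (y - e₂)⁻¹) (-(1 : ℝ) / (x - e₂) ^ 2) x := h1.inv h0
  have h3 : HasDerivAt (fun y => e₂ + a * (y - e₂)⁻¹) (a * (-(1 : ℝ) / (x - e₂) ^ 2)) x :=
    (h2.const_mul a).const_add e₂
  have h4 : (fun y : ℝ => e₂ + a / (y - e₂)) = fun y => e₂ + a * (y - e₂)⁻¹ := by
    funext y
    rw [div_eq_mul_inv]
  rw [h4]
  refine h3.congr_deriv ?_
  ring

/-- On `(e₁, ∞)` the translate `Φ(x)` lies in the oval `(e₃, e₂)`. [folklore] -/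
theorem phi_mem_Ioo {e₁ e₂ : ℝ} (h21 : e₂ < e₁) (h32 : -e₁ - e₂ < e₂) {x : ℝ} (hx : e₁ < x) :
    e₂ + (e₂ - e₁) * (e₁ + 2 * e₂) / (x - e₂) ∈ Ioo (-e₁ - e₂) e₂ := by
  have hx2 : 0 < x - e₂ := by linarith
  have ha : (e₂ - e₁) * (e₁ + 2 * e₂) < 0 := mul_neg_of_neg_of_pos (by linarith) (by linarith)
  constructor
  · have : e₂ + (e₂ - e₁) * (e₁ + 2 * e₂) / (x - e₂) - (-e₁ - e₂) =
        (e₁ + 2 * e₂) * (x - e₁) / (x - e₂) := by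
      field_simp
      ring
    have hpos : 0 < (e₁ + 2 * e₂) * (x - e₁) / (x - e₂) :=
      div_pos (mul_pos (by linarith) (by linarith)) hx2
    linarith
  · have : (e₂ - e₁) * (e₁ + 2 * e₂) / (x - e₂) < 0 := div_neg_of_neg_of_pos ha hx2
    linarith

/-- Every point of the oval `(e₃, e₂)` is `Φ(x)` for a (unique) `x > e₁`, namely `x = Φ(y)`.
[folklore] -/
theorem lt_phi_of_mem_Ioo {e₁ e₂ : ℝ} (h21 : e₂ < e₁) {y : ℝ} (hy : y ∈ Ioo (-e₁ - e₂) e₂) : e₁ < e₂ + (e₂ - e₁) * (e₁ + 2 * e₂) / (y - e₂) := by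
  have hy2 : y - e₂ < 0 := by linarith [hy.2]
  have : e₂ + (e₂ - e₁) * (e₁ + 2 * e₂) / (y - e₂) - e₁ =
      (e₂ - e₁) * (y + e₁ + e₂) / (y - e₂) := by
    have : y - e₂ ≠ 0 := hy2.ne
    field_simp
    ring
  have hpos : 0 < (e₂ - e₁) * (y + e₁ + e₂) / (y - e₂) :=
    div_pos_of_neg_of_neg (mul_neg_of_neg_of_pos (by linarith) (by linarith [hy.1])) hy2
  linarith

/-- The image of `(e₁, ∞)` under `Φ` is exactly the oval `(e₃, e₂)`. [folklore] -/
theorem image_phi_eq {e₁ e₂ : ℝ} (h21 : e₂ < e₁) (h32 : -e₁ - e₂ < e₂) :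
    (fun p : Fin 1 → ℝ => fun _ : Fin 1 => e₂ + (e₂ - e₁) * (e₁ + 2 * e₂) / (p 0 - e₂)) ''
        {p : Fin 1 → ℝ | e₁ < p 0} = {p : Fin 1 → ℝ | -e₁ - e₂ < p 0 ∧ p 0 < e₂} := by
  have ha : (e₂ - e₁) * (e₁ + 2 * e₂) ≠ 0 :=
    (mul_neg_of_neg_of_pos (by linarith) (by linarith)).ne
  ext q
  simp only [mem_image, mem_setOf_eq]
  constructor
  · rintro ⟨p, hp, rfl⟩
    exact phi_mem_Ioo h21 h32 hp
  · rintro hq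
    refine ⟨fun _ => e₂ + (e₂ - e₁) * (e₁ + 2 * e₂) / (q 0 - e₂), lt_phi_of_mem_Ioo h21 hq, ?_⟩
    funext i
    rw [Fin.fin_one_eq_zero i]
    exact phi_phi ha hq.2.ne

/-! ### `Φ` is `ℚ`-semialgebraic (one Tarski–Seidenberg projection) -/

/-- **`Φ` is `ℚ`-semialgebraic on `(e₁, ∞)`.** Although `e₂` is irrational in general, the graph of
`Φ(x) = e₂ + (e₂ − e₁)(e₂ − e₃)/(x − e₂)` over `σ'' = (e₁, ∞)` is the projection forgetting `t` of
the `ℚ`-semialgebraic set `{(x, y, t) | x ∈ σ'', f(t) = 0, 12t² − q₂ < 0, 4(y − t)(x − t) = 12t² − q₂}`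
(`e₂` is the unique root of `f` at which `f′ = 12t² − q₂` is negative, and
`f′(e₂) = 4(e₂ − e₁)(e₂ − e₃)`), hence `ℚ`-semialgebraic by the Tarski–Seidenberg theorem
(`tarski_seidenberg_real_holds`). [cite: BochnakCosteRoy1998, Thm. 2.2.1] -/
theorem phi_semialgebraic {q₂ q₃ : ℚ} {e₁ e₂ : ℝ} (h21 : e₂ < e₁) (h32 : -e₁ - e₂ < e₂)
    (hA : (q₂ : ℝ) = 4 * (e₁ ^ 2 + e₁ * e₂ + e₂ ^ 2)) (hB : (q₃ : ℝ) = -4 * e₁ * e₂ * (e₁ + e₂))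
    (hS : IsSemialgebraic ℚ {p : Fin 1 → ℝ | e₁ < p 0}) :
    IsSemialgebraicFunOn ℚ {p : Fin 1 → ℝ | e₁ < p 0}
      (fun p => e₂ + (e₂ - e₁) * (e₁ + 2 * e₂) / (p 0 - e₂)) := by
  have hf : ∀ t : ℝ, 4 * t ^ 3 - (q₂ : ℝ) * t - (q₃ : ℝ) =
      4 * (t - e₁) * (t - e₂) * (t + e₁ + e₂) := fun t => by
    rw [hA, hB]; ring
  have h12 : 12 * e₂ ^ 2 - (q₂ : ℝ) = 4 * ((e₂ - e₁) * (e₁ + 2 * e₂)) := by rw [hA]; ring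
  -- `e₂` is the only root with `f' < 0`
  have hroot : ∀ t : ℝ, 4 * t ^ 3 - (q₂ : ℝ) * t - (q₃ : ℝ) = 0 →
      12 * t ^ 2 - (q₂ : ℝ) < 0 → t = e₂ := by
    intro t ht ht'
    rw [hf] at ht
    rcases mul_eq_zero.mp ht with h | h
    · rcases mul_eq_zero.mp h with h | h
      · have hte : t = e₁ := by linarith
        rw [hte, hA] at ht'
        nlinarith
      · exact sub_eq_zero.mp h
    · have hte : t = -e₁ - e₂ := by linarith
      rw [hte, hA] at ht'
      nlinarith
  -- the semialgebraic set upstairs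
  have hW : IsSemialgebraic ℚ
      ((((fun w : Fin 3 → ℝ => w ∘ fun _ : Fin 1 => (0 : Fin 3)) ⁻¹' {p : Fin 1 → ℝ | e₁ < p 0}) ∩
        {w : Fin 3 → ℝ | 4 * w 2 ^ 3 - (q₂ : ℝ) * w 2 - (q₃ : ℝ) = 0}) ∩
        {w : Fin 3 → ℝ | 12 * w 2 ^ 2 - (q₂ : ℝ) < 0} ∩
        {w : Fin 3 → ℝ | 4 * (w 1 - w 2) * (w 0 - w 2) - (12 * w 2 ^ 2 - (q₂ : ℝ)) = 0}) := by
    refine (((hS.preimage_comp fun _ : Fin 1 => (0 : Fin 3)).inter ?_).inter ?_).inter ?_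
    · convert isSemialgebraic_setOf_eval_eq_zero (k := ℚ) (R := ℝ)
        (4 * X 2 ^ 3 - C q₂ * X 2 - C q₃ : MvPolynomial (Fin 3) ℚ) using 2 with w
      simp
    · convert isSemialgebraic_setOf_eval_pos (k := ℚ) (R := ℝ)
        (C q₂ - 12 * X 2 ^ 2 : MvPolynomial (Fin 3) ℚ) using 2 with w
      simp only [map_sub, map_mul, map_pow, aeval_X, aeval_C, eq_ratCast, sub_neg, sub_pos]
      norm_num
    · convert isSemialgebraic_setOf_eval_eq_zero (k := ℚ) (R := ℝ)
        (4 * (X 1 - X 2) * (X 0 - X 2) - (12 * X 2 ^ 2 - C q₂) : MvPolynomial (Fin 3) ℚ)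
        using 2 with w
      simp
  rw [isSemialgebraicFunOn_iff]
  convert tarski_seidenberg_real_holds hW using 1
  ext z
  have e0 : Fin.init z 0 = z 0 := rfl
  have e1 : z (Fin.last 1) = z 1 := rfl
  simp only [mem_setOf_eq, mem_image, mem_inter_iff, mem_preimage, e0, e1, Function.comp_apply]
  constructor
  · rintro ⟨hz0, hz1⟩
    refine ⟨Fin.snoc z e₂, ⟨⟨⟨?_, ?_⟩, ?_⟩, ?_⟩, ?_⟩
    · simpa [Fin.snoc] using hz0
    · simp [Fin.snoc, hf]
    · have ha : (e₂ - e₁) * (e₁ + 2 * e₂) < 0 :=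
        mul_neg_of_neg_of_pos (by linarith) (by linarith)
      have s2 : (Fin.snoc z e₂ : Fin 3 → ℝ) 2 = e₂ := by simp [Fin.snoc]
      rw [s2, h12]
      linarith
    · have hx2 : z 0 - e₂ ≠ 0 := by
        have : e₂ < z 0 := h21.trans hz0
        exact (sub_pos.mpr this).ne'
      have s0 : (Fin.snoc z e₂ : Fin 3 → ℝ) 0 = z 0 := by simp [Fin.snoc]
      have s1 : (Fin.snoc z e₂ : Fin 3 → ℝ) 1 = z 1 := by simp [Fin.snoc]
      have s2 : (Fin.snoc z e₂ : Fin 3 → ℝ) 2 = e₂ := by simp [Fin.snoc]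
      rw [s0, s1, s2, hz1, h12]
      field_simp
      ring
    · funext i
      simp
  · rintro ⟨w, ⟨⟨⟨hw0, hwr⟩, hwd⟩, hwg⟩, rfl⟩
    have hw0' : e₁ < w 0 := hw0
    have ht : w 2 = e₂ := hroot _ hwr hwd
    refine ⟨hw0', ?_⟩
    have hx2 : w 0 - e₂ ≠ 0 := by
      have : e₂ < w 0 := h21.trans hw0'
      exact (sub_pos.mpr this).ne'
    rw [ht, h12] at hwg
    have e2 : (w ∘ Fin.castSucc) 1 = w 1 := rfl
    have e3 : (w ∘ Fin.castSucc) 0 = w 0 := rfl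
    have key : w 1 - e₂ = (e₂ - e₁) * (e₁ + 2 * e₂) / (w 0 - e₂) := by
      rw [eq_div_iff hx2]
      linear_combination (1 / 4 : ℝ) * hwg
    rw [e2, e3]
    linarith [key]

end Summit.KontsevichZagierPeriods.HermiteRigidity.RealEllipticSectorKernel.DrefuteG3.MoveCopy

/-! # Part B — the stub -/

namespace Summit.KontsevichZagierPeriods.HermiteRigidity.RealEllipticSectorKernel.DrefuteG3

open Literature.NumberTheory.Transcendental Literature.ModelTheory.ExponentialFields
open Summit.KontsevichZagierPeriods.RealEllipticSectorKernel.Negative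
open Summit.KontsevichZagierPeriods.HermiteRigidity.RealEllipticSectorKernel.DrefuteG3.MoveCopy

/-! ## The move `Φ` on `ℝ¹` and its derivative -/

/-- The `2`-torsion translation `Φ(x) = e₂ + (e₂ − e₁)(e₁ + 2e₂)/(x − e₂)` on `ℝ¹`
(`(e₂ − e₁)(e₁ + 2e₂) = (e₂ − e₁)(e₂ − e₃)` when `e₃ = −e₁ − e₂`). [cite: WhittakerWatson1927, §20.33] -/
def phiMap (e₁ e₂ : ℝ) (p : Fin 1 → ℝ) : Fin 1 → ℝ :=
  fun _ => e₂ + (e₂ - e₁) * (e₁ + 2 * e₂) / (p 0 - e₂)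

/-- Its Fréchet derivative `Φ′(x) • id`, `Φ′(x) = −(e₂ − e₁)(e₁ + 2e₂)/(x − e₂)²`. [folklore] -/
def phiDeriv (e₁ e₂ : ℝ) (p : Fin 1 → ℝ) : (Fin 1 → ℝ) →L[ℝ] (Fin 1 → ℝ) :=
  (-((e₂ - e₁) * (e₁ + 2 * e₂)) / (p 0 - e₂) ^ 2) • ContinuousLinearMap.id ℝ (Fin 1 → ℝ)

theorem phiMap_apply (e₁ e₂ : ℝ) (p : Fin 1 → ℝ) (i : Fin 1) :
    phiMap e₁ e₂ p i = e₂ + (e₂ - e₁) * (e₁ + 2 * e₂) / (p 0 - e₂) := rfl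

/-- `Φ` is Fréchet differentiable off `x = e₂`, with derivative `phiDeriv`. [folklore] -/
theorem hasFDerivAt_phiMap (e₁ e₂ : ℝ) {p : Fin 1 → ℝ} (hp : p 0 ≠ e₂) :
    HasFDerivAt (phiMap e₁ e₂) (phiDeriv e₁ e₂ p) p := by
  have h1 : HasFDerivAt (fun q : Fin 1 → ℝ => q 0) (ContinuousLinearMap.proj 0) p :=
    hasFDerivAt_apply (𝕜 := ℝ) 0 p
  have h2 : HasFDerivAt
      ((fun y : ℝ => e₂ + (e₂ - e₁) * (e₁ + 2 * e₂) / (y - e₂)) ∘ fun q : Fin 1 → ℝ => q 0)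
      ((-((e₂ - e₁) * (e₁ + 2 * e₂)) / (p 0 - e₂) ^ 2) •
        ContinuousLinearMap.proj (R := ℝ) (φ := fun _ : Fin 1 => ℝ) 0) p :=
    HasDerivAt.comp_hasFDerivAt p (hasDerivAt_phi ((e₂ - e₁) * (e₁ + 2 * e₂)) e₂ (p 0) hp) h1
  rw [hasFDerivAt_pi']
  intro i
  have h3 : (ContinuousLinearMap.proj i).comp (phiDeriv e₁ e₂ p) =
      (-((e₂ - e₁) * (e₁ + 2 * e₂)) / (p 0 - e₂) ^ 2) •
        ContinuousLinearMap.proj (R := ℝ) (φ := fun _ : Fin 1 => ℝ) 0 := by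
    ext v
    simp [phiDeriv, Fin.fin_one_eq_zero i]
  rw [h3]
  exact h2

/-- `det (c • id) = c` on `ℝ¹`. [folklore] -/
theorem det_phiDeriv (e₁ e₂ : ℝ) (p : Fin 1 → ℝ) :
    (phiDeriv e₁ e₂ p).det = -((e₂ - e₁) * (e₁ + 2 * e₂)) / (p 0 - e₂) ^ 2 := by
  have h1 : ((phiDeriv e₁ e₂ p : (Fin 1 → ℝ) →L[ℝ] (Fin 1 → ℝ)) : (Fin 1 → ℝ) →ₗ[ℝ] (Fin 1 → ℝ)) =
      (-((e₂ - e₁) * (e₁ + 2 * e₂)) / (p 0 - e₂) ^ 2) • LinearMap.id := by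
    ext x i; simp [phiDeriv]
  unfold ContinuousLinearMap.det
  rw [h1, LinearMap.det_smul, LinearMap.det_id, Module.finrank_fin_fun]
  simp

/-- `Φ` is injective on `(e₁, ∞)` (indeed a Möbius involution). [folklore] -/
theorem phiMap_injOn {e₁ e₂ : ℝ} (h21 : e₂ < e₁) (h32 : -e₁ - e₂ < e₂) :
    InjOn (phiMap e₁ e₂) {p : Fin 1 → ℝ | e₁ < p 0} := by
  intro p hp q hq h
  have hp' : e₁ < p 0 := hp
  have hq' : e₁ < q 0 := hq
  have ha : (e₂ - e₁) * (e₁ + 2 * e₂) ≠ 0 :=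
    (mul_neg_of_neg_of_pos (by linarith) (by linarith)).ne
  have hp2 : p 0 - e₂ ≠ 0 := by apply ne_of_gt; linarith
  have hq2 : q 0 - e₂ ≠ 0 := by apply ne_of_gt; linarith
  have h0 := congr_fun h 0
  simp only [phiMap_apply, add_right_inj] at h0
  rw [div_eq_div_iff hp2 hq2] at h0
  have h1 : q 0 - e₂ = p 0 - e₂ := mul_left_cancel₀ ha h0
  funext i
  rw [Fin.fin_one_eq_zero i]
  linarith

/-! ## Vieta from the factorisation hypothesis -/

/-- From `4x³ − q₂x − q₃ = 4(x − e₁)(x − e₂)(x − e₃)` for all `x`: `e₃ = −e₁ − e₂`,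
`q₂ = 4(e₁² + e₁e₂ + e₂²)`, `q₃ = −4e₁e₂(e₁ + e₂)` (evaluate at `x = 0, 1, −1`). [folklore] -/
theorem vieta_of_factorisation {q₂ q₃ : ℚ} {e₁ e₂ e₃ : ℝ}
    (hf : ∀ x, cubic q₂ q₃ x = 4 * (x - e₁) * (x - e₂) * (x - e₃)) :
    e₃ = -e₁ - e₂ ∧ (q₂ : ℝ) = 4 * (e₁ ^ 2 + e₁ * e₂ + e₂ ^ 2) ∧
      (q₃ : ℝ) = -4 * e₁ * e₂ * (e₁ + e₂) := by
  have h0 := hf 0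
  have h1 := hf 1
  have h2 := hf (-1)
  simp only [cubic] at h0 h1 h2
  have hsum : e₃ = -e₁ - e₂ := by linear_combination ((1 : ℝ) / 8) * (h1 + h2 - 2 * h0)
  refine ⟨hsum, ?_, ?_⟩
  · subst hsum; linear_combination (-(1 : ℝ) / 2) * (h1 - h2)
  · subst hsum; linear_combination -h0

/-! ## The stub -/

/-- **`stub_twoTorsion`, verbatim signature (skeleton `be982d63baee…`), sorry-free.** Translation by
the `2`-torsion point `(e₂, 0)`, `Φ(x) = e₂ + (e₂−e₁)(e₂−e₃)/(x−e₂)`, is ONE rule-2 move carrying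
`[(e₁,∞), 1/√f]` onto `[(e₃,e₂), 1/√f]`: `Φ` is a `ℚ`-semialgebraic map on `(e₁,∞)`
(`phi_semialgebraic`, Tarski–Seidenberg; the domain is semialgebraic as a field of `r''`),
differentiable within the domain (`hasFDerivAt_phiMap`), injective (`phiMap_injOn`), with image
exactly `(e₃,e₂)` (`image_phi_eq`), and the Jacobian weight is exact: `f(Φx) = Φ′(x)² f(x)`
(`cubic_phi`), so `1/√f(x) = (1/√f(Φx))·|Φ′(x)|`. [cite: WhittakerWatson1927, §20.33] -/
theorem stub_twoTorsion (q₂ q₃ : ℚ) (e₁ e₂ e₃ : ℝ) (h₃₂ : e₃ < e₂) (h₂₁ : e₂ < e₁)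
    (_ha₁ : IsAlgebraic ℚ e₁) (_ha₂ : IsAlgebraic ℚ e₂) (_ha₃ : IsAlgebraic ℚ e₃)
    (hf : ∀ x, cubic q₂ q₃ x = 4 * (x - e₁) * (x - e₂) * (x - e₃))
    (r'' r : KZ.IntegralRep 1)
    (hr'' : r''.domain = {p | e₁ < p 0})
    (hri'' : EqOn r''.integrand (fun p => 1 / Real.sqrt (cubic q₂ q₃ (p 0))) r''.domain)
    (hr : r.domain = {p | e₃ < p 0 ∧ p 0 < e₂})
    (hri : EqOn r.integrand (fun p => 1 / Real.sqrt (cubic q₂ q₃ (p 0))) r.domain) :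
    KZ.of r'' - KZ.of r ∈ KZ.relations := by
  obtain ⟨he₃, hA, hB⟩ := vieta_of_factorisation hf
  have h32 : -e₁ - e₂ < e₂ := he₃ ▸ h₃₂
  have hS : IsSemialgebraic ℚ {p : Fin 1 → ℝ | e₁ < p 0} := hr'' ▸ r''.isSemialgebraic_domain
  have hf' : ∀ y, cubic q₂ q₃ y = 4 * (y - e₁) * (y - e₂) * (y + e₁ + e₂) := fun y => by
    rw [hf, he₃]; ring
  have hapos : 0 < -((e₂ - e₁) * (e₁ + 2 * e₂)) := by
    have : (e₂ - e₁) * (e₁ + 2 * e₂) < 0 := mul_neg_of_neg_of_pos (by linarith) (by linarith)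
    linarith
  refine KZ.changeOfVariablesRel_subset_relations
    ⟨1, r'', r, phiMap e₁ e₂, phiDeriv e₁ e₂, ?_, ?_, ?_, ?_, ?_, rfl⟩
  · -- `Φ` is a `ℚ`-semialgebraic map on the source domain
    rw [hr'']
    exact IsSemialgebraicMapOn.of_forall hS fun _ => phi_semialgebraic h₂₁ h32 hA hB hS
  · -- derivative within the domain
    intro p hp
    rw [hr''] at hp
    have hp : e₁ < p 0 := hp
    exact (hasFDerivAt_phiMap e₁ e₂ (ne_of_gt (h₂₁.trans hp))).hasFDerivWithinAt
  · -- injective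
    rw [hr'']
    exact phiMap_injOn h₂₁ h32
  · -- image exactly the oval
    rw [hr, hr'', he₃]
    exact (image_phi_eq h₂₁ h32).symm
  · -- exact Jacobian weight
    intro p hp
    rw [hr''] at hp
    have hp : e₁ < p 0 := hp
    have hΦmem : phiMap e₁ e₂ p ∈ r.domain := by
      rw [hr, he₃]
      exact phi_mem_Ioo h₂₁ h32 hp
    have hw1 : r''.integrand p = 1 / Real.sqrt (cubic q₂ q₃ (p 0)) := hri'' (by rw [hr'']; exact hp)
    have hw2 : r.integrand (phiMap e₁ e₂ p) =
        1 / Real.sqrt (cubic q₂ q₃ (e₂ + (e₂ - e₁) * (e₁ + 2 * e₂) / (p 0 - e₂))) := hri hΦmem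
    rw [hw1, hw2, det_phiDeriv]
    have hpe : p 0 ≠ e₂ := ne_of_gt (h₂₁.trans hp)
    have hx2 : 0 < (p 0 - e₂) ^ 2 := by
      have : 0 < p 0 - e₂ := by linarith
      positivity
    set d : ℝ := -((e₂ - e₁) * (e₁ + 2 * e₂)) / (p 0 - e₂) ^ 2 with hd
    have hdpos : 0 < d := div_pos hapos hx2
    have hfx : 0 < cubic q₂ q₃ (p 0) := by
      rw [hf']
      have h1 : 0 < p 0 - e₁ := by linarith
      have h2 : 0 < p 0 - e₂ := by linarith
      have h3 : 0 < p 0 + e₁ + e₂ := by linarith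
      positivity
    have hkey : cubic q₂ q₃ (e₂ + (e₂ - e₁) * (e₁ + 2 * e₂) / (p 0 - e₂)) =
        d ^ 2 * cubic q₂ q₃ (p 0) := by
      rw [hf', hf', hd]
      exact cubic_phi e₁ e₂ (p 0) hpe
    rw [hkey, Real.sqrt_mul' _ hfx.le, Real.sqrt_sq hdpos.le, abs_of_pos hdpos]
    have hs : 0 < Real.sqrt (cubic q₂ q₃ (p 0)) := Real.sqrt_pos.mpr hfx
    field_simp

end Summit.KontsevichZagierPeriods.HermiteRigidity.RealEllipticSectorKernel.DrefuteG3

end
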